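import Summits.NavierStokesRegularity.FluidComputer.RiccatiInequalityGen
import Summits.NavierStokesRegularity.FluidComputer.PowerComparison
import Summits.NavierStokesRegularity.FluidComputer.HomSobolev32Clock
import HarnessLib

/-!
# Fluid computer — L58: the OPTIMAL `Ḣ^s` rows for `3/2 < s < 5/2` (Robinson–Sadowski–Silva's rate,
# via Cheskidov–Zaya's Riccati law): `‖u(t)‖_{Ḣ^s} ≥ c_s ν^{(5−2s)/4} (T − t)^{−(2s−1)/4}`

HONEST FRAMING (cell `pub-fluidc`, verbatim): *low prior, high value-of-information experiment on Tao's
machine paradigm; NOT a claim that NS blows up.* Theorem side of the cell (the level dictionary); nothing here is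
evidence of blow-up — necessities for EVERY maximal smooth finite-energy solution on `ℝ³`.

L52 gave the scaling-sharp rate `(2s−1)/4` for `1/2 < s < 3/2`, L56/L57 the endpoint `s = 3/2`, while above `3/2` the
dictionary had only Benameur's NON-optimal exponent `σ/3` (L53/L54/L54-H). This file closes the gap up to `s < 5/2`:

* `exists_row_gt` — every row `∑_j 2^{κj} a_j(t)²`, `2 ≤ κ ≤ 5`, is unbounded on every terminal window;
* `row_clock_gen` (**L58 — THE OPTIMAL `Ḃ^{κ/2}_{2,2}` ROWS, `3 < κ < 5`**) — one `c = c_κ > 0` with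
  `c ν^{(5−κ)/2} (T − t)^{−(κ−1)/2} ≤ ∑_j 2^{κj} ‖Δ̇_j u(t)‖₂²` at EVERY `t ∈ (0, T)`: the integrated Riccati law
  `Y(b) − Y(t) ≤ K ν^{−(5−κ)/(κ−1)} ∫_t^b Y^{(κ+1)/(κ−1)}` (`RiccatiInequalityGen.row_two_point_gen`), the power-law
  comparison `PowerComparison.rpow_mul_le_of_rpow` (`q = 2/(κ−1)`) run from `t` on `Y + ε`, and the divergence of `Y`;
* `homSobolev_clock_gen_sq`, `homSobolev_clock_gen` (**L58 IN `Ḣ^s`**) — for every `s ∈ (3/2, 5/2)`: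
  `c_s ν^{(5−2s)/4} (T − t)^{−(2s−1)/4} ≤ ‖u(t)‖_{Ḣ^s}` — the SAME shape as L52/L57, i.e. the Sobolev ladder
  `‖u(t)‖_{Ḣ^s} ≳ ν^{(5−2s)/4}(T−t)^{−(2s−1)/4}` now holds for EVERY `s ∈ (1/2, 5/2)` (Robinson–Sadowski–Silva 2012's
  optimal rate on the whole range, the case `s > 3/2` by Cheskidov–Zaya's Riccati route).

0 sorry; no definitions; no named facts.

## References

* A. Cheskidov, K. Zaya, J. Math. Phys. 57 (2016) 023101 = arXiv:1503.01784, Remark 2.3, Thm. 2.4. [CheskidovZaya2016]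
* J. C. Robinson, W. Sadowski, R. P. Silva, J. Math. Phys. 53 (2012) 115618, Thm. 1.1. [RobinsonSadowskiSilva2012]
-/

noncomputable section

open MeasureTheory Set Function Filter Topology
open scoped ENNReal NNReal
open Literature.Analysis.FluidPDE Literature.Analysis.FunctionSpaces
open Summit.NavierStokesRegularity.FluidComputer.BlockEnergyTransport
open Summit.NavierStokesRegularity.FluidComputer.RiccatiInequality
open Summit.NavierStokesRegularity.FluidComputer.RiccatiInequalityGen
open Summit.NavierStokesRegularity.FluidComputer.RiccatiSlice
open Summit.NavierStokesRegularity.FluidComputer.PowerComparison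
open Summit.NavierStokesRegularity.FluidComputer.LerayFrontClock
open Summit.NavierStokesRegularity.FluidComputer.HomSobolev32Clock
open Summit.NavierStokesRegularity.FluidComputer.SobolevLadderFront (tendsto_ofReal_clock_top)

namespace Summit.NavierStokesRegularity.FluidComputer.OptimalSobolevClock

/-! ## Divergence of the rows -/

/-- **Every row `∑_j 2^{κj} ‖Δ̇_j u(t)‖₂²`, `2 ≤ κ ≤ 5`, is unbounded on every terminal window** along a maximal smooth
Leray–Hopf solution of the unforced system (`ν > 0`): for every `t₀ < T` and every real `M` there is
`b ∈ (t₀, T) ∩ (0, T)` where the row is finite and exceeds `M` (the dyadic enstrophy clock L20 and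
`F ≤ 8‖u(0)‖₂² + ∑_{n≥0} 4^n a_n² ≤ 8‖u(0)‖₂² + Y_κ`, `4^n ≤ 2^{κn}`). [cite: RobinsonRodrigoSadowski2016, Lemma 6.11] -/
theorem exists_row_gt {κ : ℝ} (hκ2 : 2 ≤ κ) (hκ5 : κ ≤ 5) {ν T : ℝ} (hν : 0 < ν) (hT : 0 < T)
    {u : ℝ → EuclideanSpace ℝ (Fin 3) → EuclideanSpace ℝ (Fin 3)} {p : ℝ → EuclideanSpace ℝ (Fin 3) → ℝ}
    (hmax : IsMaximalSmoothSolution ν 0 u p T) (hLH : IsLerayHopfOn T ν 0 (u 0) u)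
    {t₀ : ℝ} (ht₀ : t₀ < T) (M : ℝ) :
    ∃ b ∈ Ioo (max t₀ 0) T,
      M < (∑' j : ℤ, (2 : ℝ≥0∞) ^ (κ * (j : ℝ)) * blockL2 (u b) j ^ 2).toReal := by
  obtain ⟨c, hc, H⟩ := dyadicF_clock
  set K := lpBounds (Fin 3) with hK
  have hu0 : MemLp (u 0) 2 volume := hLH.memLp 0 ⟨le_rfl, hT.le⟩
  set E' : ℝ≥0∞ := 8 * eLpNorm (u 0) 2 volume ^ 2 with hE'
  have hE'top : E' ≠ ∞ := ENNReal.mul_ne_top (by norm_num) (ENNReal.pow_ne_top hu0.eLpNorm_ne_top)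
  set M' : ℝ≥0∞ := ENNReal.ofReal M with hM'
  set Qe : ℝ≥0∞ := (6 * (K.Cb : ℝ≥0∞) ^ 2 * (E' + M')) ^ 2 with hQe
  have hQetop : Qe ≠ ∞ := ENNReal.pow_ne_top (ENNReal.mul_ne_top
    (ENNReal.mul_ne_top (by norm_num) (ENNReal.pow_ne_top ENNReal.coe_ne_top))
    (ENNReal.add_ne_top.2 ⟨hE'top, ENNReal.ofReal_ne_top⟩))
  set Q : ℝ := Qe.toReal with hQ
  have hQ0 : 0 ≤ Q := ENNReal.toReal_nonneg
  set t₁ : ℝ := max t₀ 0 with ht₁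
  have ht₁T : t₁ < T := max_lt ht₀ hT
  set d : ℝ := min ((T - t₁) / 2) (c * ν ^ 3 / (2 * (Q + 1))) with hd
  have hd0 : 0 < d := lt_min (by linarith) (by positivity)
  have hd1 : d ≤ (T - t₁) / 2 := min_le_left _ _
  have hd2 : d ≤ c * ν ^ 3 / (2 * (Q + 1)) := min_le_right _ _
  set b : ℝ := T - d with hb
  have hbI : b ∈ Ioo t₁ T := ⟨by linarith, by linarith⟩
  have hb0T : b ∈ Ioo 0 T := ⟨(le_max_right t₀ 0).trans_lt hbI.1, hbI.2⟩
  have hsmall : Q * (T - b) < c * ν ^ 3 := by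
    have hTb : T - b = d := by rw [hb]; ring
    rw [hTb]
    have h1 : Q * d ≤ Q * (c * ν ^ 3 / (2 * (Q + 1))) := mul_le_mul_of_nonneg_left hd2 hQ0
    have h2 : Q * (c * ν ^ 3 / (2 * (Q + 1))) < c * ν ^ 3 := by
      rw [mul_div_assoc', div_lt_iff₀ (by positivity)]
      nlinarith [mul_pos hc (pow_pos hν 3)]
    linarith
  refine ⟨b, hbI, ?_⟩
  set y : ℝ≥0∞ := ∑' j : ℤ, (2 : ℝ≥0∞) ^ (κ * (j : ℝ)) * blockL2 (u b) j ^ 2 with hy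
  have hytop : y ≠ ∞ :=
    tsum_weighted_sq_ne_top (isSmoothL2Field_slice_of_maximal hν hT hmax hLH hb0T) (by linarith) hκ5
  have hFle : dyadicF (u b) ≤ E' + y := by
    have h := dyadicF_le_head_add_tail hν hT hLH ⟨hb0T.1.le, hb0T.2⟩ 0
    simp only [mul_zero, pow_zero, mul_one, zero_add] at h
    refine h.trans (add_le_add le_rfl ?_)
    calc ∑' n : ℕ, (2 : ℝ≥0∞) ^ (2 * n) * blockL2 (u b) (n : ℤ) ^ 2
        ≤ ∑' n : ℕ, (2 : ℝ≥0∞) ^ (κ * (((n : ℤ)) : ℝ)) * blockL2 (u b) (n : ℤ) ^ 2 := by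
          refine ENNReal.tsum_le_tsum fun n => mul_le_mul' ?_ le_rfl
          rw [show ((2 : ℝ≥0∞) ^ (2 * n) : ℝ≥0∞) = (2 : ℝ≥0∞) ^ (((2 * n : ℕ)) : ℝ) by
            rw [ENNReal.rpow_natCast]]
          refine ENNReal.rpow_le_rpow_of_exponent_le one_le_two ?_
          have hn : (0 : ℝ) ≤ n := Nat.cast_nonneg n
          push_cast
          nlinarith
      _ ≤ y := ENNReal.tsum_comp_le_tsum_of_injective Nat.cast_injective
          (fun j : ℤ => (2 : ℝ≥0∞) ^ (κ * (j : ℝ)) * blockL2 (u b) j ^ 2)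
  by_contra hle
  push Not at hle
  have hyM : y ≤ M' := by
    rw [hM', ← ENNReal.ofReal_toReal hytop]
    exact ENNReal.ofReal_le_ofReal hle
  have hclock := H ν T hν hT u p hmax hLH b hb0T
  have hQle : (6 * (K.Cb : ℝ≥0∞) ^ 2 * dyadicF (u b)) ^ 2 * ENNReal.ofReal (T - b) ≤ Qe * ENNReal.ofReal (T - b) := by
    rw [hQe]
    gcongr
    exact hFle.trans (add_le_add le_rfl hyM)
  have hQe' : Qe * ENNReal.ofReal (T - b) = ENNReal.ofReal (Q * (T - b)) := by
    rw [ENNReal.ofReal_mul hQ0, hQ, ENNReal.ofReal_toReal hQetop]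
  have h := (hclock.trans hQle).trans_eq hQe'
  rw [ENNReal.ofReal_le_ofReal_iff (mul_nonneg hQ0 (by linarith [hb0T.2]))] at h
  linarith

/-! ## L58: the optimal rows for `3 < κ < 5` -/

/-- **L58 — THE OPTIMAL `Ḃ^{κ/2}_{2,2}` ROWS, `3 < κ < 5` (Cheskidov–Zaya's Riccati route to Robinson–Sadowski–Silva's
rate).** For every `κ ∈ (3, 5)` there is `c = c_κ > 0` such that for every `ν > 0`, `T > 0`, every maximal smooth
solution `(u, p)` of the unforced Navier–Stokes system on `ℝ³ × [0, T)` which is Leray–Hopf from `u 0`, and EVERY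
`t ∈ (0, T)`:
`c · ν^{(5−κ)/2} · (T − t)^{−(κ−1)/2} ≤ ∑_{j∈ℤ} 2^{κj} ‖Δ̇_j u(t)‖₂²`
— with `κ = 2s`: `∑_j 4^{sj} a_j(t)² ≳ ν^{(5−2s)/2} (T − t)^{−(2s−1)/2}`, the square of the scaling-sharp, rate-optimal
`Ḣ^s` bound for `3/2 < s < 5/2`. Proof: the integrated Riccati law `Y(b) − Y(t) ≤ K ν^{−β}∫_t^b Y^{1+q}`
(`β = (5−κ)/(κ−1)`, `q = 2/(κ−1)`; `row_two_point_gen`); were `q K ν^{−β} (Y(t)+ε)^q (T − t) < 1`, the comparison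
`rpow_mul_le_of_rpow` (on `Y(t + ·) + ε`, continuous by `continuousOn_row`) would keep `Y` bounded on `[t, T)`,
contradicting `exists_row_gt`; hence `q K ν^{−β} Y(t)^q (T − t) ≥ 1`, i.e. `Y(t) ≥ (qK)^{−1/q} ν^{β/q} (T−t)^{−1/q}` with
`1/q = (κ−1)/2`, `β/q = (5−κ)/2`. Necessity only. [cite: CheskidovZaya2016, Remark 2.3, Thm. 2.4]
[cite: RobinsonSadowskiSilva2012, Thm. 1.1] -/
theorem row_clock_gen {κ : ℝ} (hκ3 : 3 < κ) (hκ5 : κ < 5) :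
    ∃ c : ℝ, 0 < c ∧ ∀ (ν T : ℝ), 0 < ν → 0 < T →
      ∀ (u : ℝ → EuclideanSpace ℝ (Fin 3) → EuclideanSpace ℝ (Fin 3)) (p : ℝ → EuclideanSpace ℝ (Fin 3) → ℝ),
      IsMaximalSmoothSolution ν 0 u p T → IsLerayHopfOn T ν 0 (u 0) u →
      ∀ t ∈ Ioo 0 T,
        ENNReal.ofReal (c * ν ^ ((5 - κ) / 2) * (T - t) ^ (-((κ - 1) / 2))) ≤
          ∑' j : ℤ, (2 : ℝ≥0∞) ^ (κ * (j : ℝ)) * blockL2 (u t) j ^ 2 := by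
  obtain ⟨K, hK, hRic⟩ := row_two_point_gen hκ3 hκ5
  set q : ℝ := 2 / (κ - 1) with hq
  set β : ℝ := (5 - κ) / (κ - 1) with hβ
  have hκ1 : 0 < κ - 1 := by linarith
  have hq0 : 0 < q := by rw [hq]; positivity
  have hpw : (κ + 1) / (κ - 1) = 1 + q := by rw [hq]; field_simp; ring
  have hq1 : 1 / q = (κ - 1) / 2 := by rw [hq, one_div_div]
  have hβq : β * (1 / q) = (5 - κ) / 2 := by rw [hq1, hβ]; field_simp
  refine ⟨(q * K) ^ (-(1 / q)), by positivity, fun ν T hν hT u p hmax hLH t₀ ht₀ => ?_⟩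
  set Y : ℝ → ℝ := fun τ => (∑' j : ℤ, (2 : ℝ≥0∞) ^ (κ * (j : ℝ)) * blockL2 (u τ) j ^ 2).toReal with hY
  have hY0 : ∀ τ, 0 ≤ Y τ := fun τ => ENNReal.toReal_nonneg
  set Lr : ℝ := K * ν ^ (-β) with hLr
  have hLr0 : 0 < Lr := mul_pos hK (Real.rpow_pos_of_pos hν _)
  have hTt : 0 < T - t₀ := sub_pos.2 ht₀.2
  -- the key claim: for every `ε > 0`, `1 ≤ q Lr (Y t₀ + ε)^q (T - t₀)`
  have hclaim : ∀ ε : ℝ, 0 < ε → 1 ≤ q * Lr * (Y t₀ + ε) ^ q * (T - t₀) := by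
    intro ε hε
    by_contra hlt
    push Not at hlt
    set A : ℝ := Y t₀ + ε with hA
    have hA0 : 0 < A := by have := hY0 t₀; linarith
    have hAq : 0 < A ^ q := Real.rpow_pos_of_pos hA0 _
    set θ : ℝ := 1 - q * Lr * A ^ q * (T - t₀) with hθ
    have hθ0 : 0 < θ := by linarith
    obtain ⟨b, hb, hMb⟩ := exists_row_gt (by linarith) hκ5.le hν hT hmax hLH ht₀.2 ((A ^ q / θ) ^ (1 / q))
    have hb1 : t₀ < b := (le_max_left t₀ 0).trans_lt hb.1
    have hbT : b < T := hb.2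
    have hYc : ContinuousOn Y (Icc t₀ b) := continuousOn_row (by linarith) hκ5.le hν hT hmax hLH ht₀.1 hb1.le hbT
    set G : ℝ → ℝ := fun τ => Y (t₀ + τ) + ε with hG
    have hmaps : MapsTo (fun τ : ℝ => t₀ + τ) (Icc 0 (b - t₀)) (Icc t₀ b) := fun τ hτ =>
      ⟨by linarith [hτ.1], by linarith [hτ.2]⟩
    have hGc : ContinuousOn G (Icc 0 (b - t₀)) :=
      ((hYc.comp (continuous_const.add continuous_id).continuousOn hmaps).add continuousOn_const)
    have hG0 : ∀ τ ∈ Icc 0 (b - t₀), 0 ≤ G τ := fun τ _ => by have := hY0 (t₀ + τ); simp only [hG]; linarith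
    have hGε : ∀ τ, ε ≤ G τ := fun τ => by have := hY0 (t₀ + τ); simp only [hG]; linarith
    have hpos : 0 < G 0 := by simp only [hG, add_zero]; exact hA0
    have hGpc : ∀ b' ∈ Icc 0 (b - t₀), ContinuousOn (fun τ => G τ ^ (1 + q)) (uIcc 0 b') := fun b' hb' => by
      rw [uIcc_of_le hb'.1]
      exact (hGc.mono (Icc_subset_Icc le_rfl hb'.2)).rpow_const fun τ _ => Or.inr (by linarith)
    have hYpc : ∀ b' ∈ Icc 0 (b - t₀), ContinuousOn (fun τ => Y (t₀ + τ) ^ (1 + q)) (uIcc 0 b') := fun b' hb' => by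
      rw [uIcc_of_le hb'.1]
      exact ((hYc.comp (continuous_const.add continuous_id).continuousOn hmaps).mono
        (Icc_subset_Icc le_rfl hb'.2)).rpow_const fun τ _ => Or.inr (by linarith)
    have hineq : ∀ b' ∈ Icc 0 (b - t₀), G b' ≤ G 0 + Lr * ∫ τ in (0 : ℝ)..b', G τ ^ (1 + q) := by
      intro b' hb'
      have h2 := hRic ν T hν hT u p hmax hLH t₀ (t₀ + b') ht₀.1 (by linarith [hb'.1]) (by linarith [hb'.2])
      rw [hpw] at h2
      have hshift : ∫ τ in t₀..(t₀ + b'), Y τ ^ (1 + q) = ∫ τ in (0 : ℝ)..b', Y (t₀ + τ) ^ (1 + q) := by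
        rw [intervalIntegral.integral_comp_add_left (fun τ => Y τ ^ (1 + q)) t₀, add_zero]
      have hmono : ∫ τ in (0 : ℝ)..b', Y (t₀ + τ) ^ (1 + q) ≤ ∫ τ in (0 : ℝ)..b', G τ ^ (1 + q) := by
        refine intervalIntegral.integral_mono_on hb'.1 (hYpc b' hb').intervalIntegrable
          (hGpc b' hb').intervalIntegrable fun τ _ => ?_
        exact Real.rpow_le_rpow (hY0 _) (by simp only [hG]; linarith) (by linarith)
      have h3 : Y (t₀ + b') - Y t₀ ≤ Lr * ∫ τ in (0 : ℝ)..b', G τ ^ (1 + q) := by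
        calc Y (t₀ + b') - Y t₀ ≤ K * ν ^ (-β) * ∫ τ in t₀..(t₀ + b'), Y τ ^ (1 + q) := h2
          _ ≤ Lr * ∫ τ in (0 : ℝ)..b', G τ ^ (1 + q) := by
              rw [hshift, hLr]
              exact mul_le_mul_of_nonneg_left hmono hLr0.le
      simp only [hG, add_zero]
      linarith
    have hcomp := rpow_mul_le_of_rpow hLr0.le (by linarith : 0 < b - t₀) hq0 hGc hG0 hpos hineq (b - t₀)
      ⟨by linarith, le_rfl⟩
    simp only [hG, add_zero, add_sub_cancel] at hcomp
    -- `1 - q Lr A^q (b - t₀) ≥ θ > 0`, hence `(Y b + ε)^q ≤ A^q / θ`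
    have hφ : θ ≤ 1 - q * Lr * (Y t₀ + ε) ^ q * (b - t₀) := by
      have : q * Lr * A ^ q * (b - t₀) ≤ q * Lr * A ^ q * (T - t₀) :=
        mul_le_mul_of_nonneg_left (by linarith) (by positivity)
      rw [hθ, hA]; linarith
    have hYbε : 0 ≤ (Y b + ε) ^ q := Real.rpow_nonneg (by linarith [hY0 b]) _
    have h4 : (Y b + ε) ^ q * θ ≤ A ^ q := by
      calc (Y b + ε) ^ q * θ ≤ (Y b + ε) ^ q * (1 - q * Lr * (Y t₀ + ε) ^ q * (b - t₀)) :=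
            mul_le_mul_of_nonneg_left hφ hYbε
        _ ≤ (Y t₀ + ε) ^ q := hcomp
        _ = A ^ q := rfl
    have h5 : (Y b + ε) ^ q ≤ A ^ q / θ := (le_div_iff₀ hθ0).2 h4
    have h6 : Y b + ε ≤ (A ^ q / θ) ^ (1 / q) := by
      have h := Real.rpow_le_rpow hYbε h5 (by positivity : (0 : ℝ) ≤ 1 / q)
      rwa [← Real.rpow_mul (by linarith [hY0 b]), mul_one_div_cancel hq0.ne', Real.rpow_one] at h
    linarith
  -- let `ε → 0`
  have hmain : 1 ≤ q * Lr * Y t₀ ^ q * (T - t₀) := by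
    by_contra hlt
    push Not at hlt
    have hcont : ContinuousAt (fun ε : ℝ => q * Lr * (Y t₀ + ε) ^ q * (T - t₀)) 0 := by
      have h1 : ContinuousAt (fun ε : ℝ => (Y t₀ + ε) ^ q) 0 :=
        ((continuous_const.add continuous_id).continuousAt).rpow_const (Or.inr hq0.le)
      exact (continuousAt_const.mul h1).mul continuousAt_const
    have hev : ∀ᶠ ε in 𝓝[>] (0 : ℝ), q * Lr * (Y t₀ + ε) ^ q * (T - t₀) < 1 := by
      have h := (tendsto_order.1 hcont.tendsto).2 1 (by simpa using hlt)
      exact h.filter_mono nhdsWithin_le_nhds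
    obtain ⟨ε, hε, hεpos⟩ := (hev.and self_mem_nhdsWithin).exists
    exact absurd (hclaim ε hεpos) (not_le.2 hε)
  -- conclude: `Y t₀ ≥ (q K ν^{-β} (T - t₀))^{-1/q}`
  have hYq : (q * Lr * (T - t₀))⁻¹ ≤ Y t₀ ^ q := by
    rw [inv_le_iff_one_le_mul₀ (by positivity)]
    calc (1 : ℝ) ≤ q * Lr * Y t₀ ^ q * (T - t₀) := hmain
      _ = Y t₀ ^ q * (q * Lr * (T - t₀)) := by ring
  have hYt : (q * K) ^ (-(1 / q)) * ν ^ ((5 - κ) / 2) * (T - t₀) ^ (-((κ - 1) / 2)) ≤ Y t₀ := by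
    have h := Real.rpow_le_rpow (by positivity) hYq (by positivity : (0 : ℝ) ≤ 1 / q)
    rw [← Real.rpow_mul (hY0 t₀), mul_one_div_cancel hq0.ne', Real.rpow_one] at h
    refine le_trans (le_of_eq ?_) h
    have eX : q * Lr * (T - t₀) = (q * K) * (ν ^ (-β) * (T - t₀)) := by rw [hLr]; ring
    have hX0 : 0 ≤ (q * K) * (ν ^ (-β) * (T - t₀)) := by positivity
    have e1 : -β * -(1 / q) = (5 - κ) / 2 := by rw [neg_mul_neg, hβq]
    have e3 : (T - t₀) ^ (-(1 / q)) = (T - t₀) ^ (-((κ - 1) / 2)) := by rw [hq1]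
    have key : ((q * K) * (ν ^ (-β) * (T - t₀))) ^ (-(1 / q)) =
        (q * K) ^ (-(1 / q)) * ν ^ ((5 - κ) / 2) * (T - t₀) ^ (-((κ - 1) / 2)) := by
      rw [Real.mul_rpow (by positivity) (by positivity), Real.mul_rpow (Real.rpow_nonneg hν.le _) hTt.le,
        ← Real.rpow_mul hν.le, e1, e3]
      ring
    rw [Real.inv_rpow (by positivity), eX, ← Real.rpow_neg hX0, key]
  calc ENNReal.ofReal ((q * K) ^ (-(1 / q)) * ν ^ ((5 - κ) / 2) * (T - t₀) ^ (-((κ - 1) / 2)))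
      ≤ ENNReal.ofReal (Y t₀) := ENNReal.ofReal_le_ofReal hYt
    _ = _ := ENNReal.ofReal_toReal (tsum_weighted_sq_ne_top
        (isSmoothL2Field_slice_of_maximal hν hT hmax hLH ht₀) (by linarith) hκ5.le)

/-! ## L58 in the `Ḣ^s` currency, `3/2 < s < 5/2` -/

/-- **L58 IN `Ḣ^s`, squared form.** For every `s ∈ (3/2, 5/2)` there is `c = c_s > 0` such that along every maximal
smooth Leray–Hopf solution of the unforced system (`ν > 0`), at EVERY `t ∈ (0, T)`:
`c · ν^{(5−2s)/2} · (T − t)^{−(2s−1)/2} ≤ ‖u(t)‖²_{Ḣ^s}` (`row_clock_gen` at `κ = 2s` read through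
`∑_j 4^{sj}a_j² ≤ 8·4^s ‖u‖²_{Ḣ^s}`, `HomSobolev32Clock.tsum_weight_blockL2_sq_le`). [cite: CheskidovZaya2016, Remark 2.3]
[cite: RobinsonSadowskiSilva2012, Thm. 1.1] -/
theorem homSobolev_clock_gen_sq (s : ℝ) (hs : s ∈ Ioo (3 / 2 : ℝ) (5 / 2)) :
    ∃ c : ℝ, 0 < c ∧ ∀ (ν T : ℝ), 0 < ν → 0 < T →
      ∀ (u : ℝ → EuclideanSpace ℝ (Fin 3) → EuclideanSpace ℝ (Fin 3)) (p : ℝ → EuclideanSpace ℝ (Fin 3) → ℝ),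
      IsMaximalSmoothSolution ν 0 u p T → IsLerayHopfOn T ν 0 (u 0) u →
      ∀ t ∈ Ioo 0 T,
        ENNReal.ofReal (c * ν ^ ((5 - 2 * s) / 2) * (T - t) ^ (-((2 * s - 1) / 2))) ≤
          Function.eHomSobolevSeminorm s (⇑EuclideanSpace.complexify ∘ u t) ^ 2 := by
  obtain ⟨c, hc, H⟩ := row_clock_gen (κ := 2 * s) (by linarith [hs.1]) (by linarith [hs.2])
  set M : ℝ := 8 * (2 : ℝ) ^ (2 * s) with hM
  have hM0 : 0 < M := by positivity
  have hMe : (8 : ℝ≥0∞) * (2 : ℝ≥0∞) ^ |2 * s| = ENNReal.ofReal M := by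
    rw [abs_of_pos (by linarith [hs.1]), hM, ENNReal.ofReal_mul (by norm_num), ← ENNReal.ofReal_rpow_of_pos two_pos,
      ENNReal.ofReal_ofNat, ENNReal.ofReal_ofNat]
  refine ⟨c / M, by positivity, fun ν T hν hT u p hmax hLH t ht => ?_⟩
  have hTt : 0 < T - t := sub_pos.2 ht.2
  have hut : MemLp (u t) 2 volume := hLH.memLp t ⟨ht.1.le, ht.2.le⟩
  have h1 := H ν T hν hT u p hmax hLH t ht
  have h2 := tsum_weight_blockL2_sq_le s hut
  rw [hMe] at h2
  have h3 := h1.trans h2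
  have e : c / M * ν ^ ((5 - 2 * s) / 2) * (T - t) ^ (-((2 * s - 1) / 2)) =
      M⁻¹ * (c * ν ^ ((5 - 2 * s) / 2) * (T - t) ^ (-((2 * s - 1) / 2))) := by field_simp
  rw [e, ENNReal.ofReal_mul (by positivity), ENNReal.ofReal_inv_of_pos hM0]
  have hMne : ENNReal.ofReal M ≠ 0 := by rwa [ne_eq, ENNReal.ofReal_eq_zero, not_le]
  calc (ENNReal.ofReal M)⁻¹ * ENNReal.ofReal (c * ν ^ ((5 - 2 * s) / 2) * (T - t) ^ (-((2 * s - 1) / 2)))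
      ≤ (ENNReal.ofReal M)⁻¹ * (ENNReal.ofReal M * Function.eHomSobolevSeminorm s (⇑EuclideanSpace.complexify ∘ u t) ^ 2) :=
        mul_le_mul_right h3 _
    _ = Function.eHomSobolevSeminorm s (⇑EuclideanSpace.complexify ∘ u t) ^ 2 := by
        rw [← mul_assoc, ENNReal.inv_mul_cancel hMne ENNReal.ofReal_ne_top, one_mul]

/-- **L58 — THE SOBOLEV LADDER AT THE OPTIMAL RATE ABOVE `3/2`: for every `s ∈ (3/2, 5/2)` there is `c = c_s > 0`
such that for every `ν > 0`, `T > 0`, every maximal smooth solution `(u, p)` of the unforced Navier–Stokes system on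
`ℝ³ × [0, T)` which is Leray–Hopf from `u 0`, and EVERY `t ∈ (0, T)`:
`c · ν^{(5−2s)/4} · (T − t)^{−(2s−1)/4} ≤ ‖u(t)‖_{Ḣ^s}`** — the same shape as L52 (`1/2 < s < 3/2`) and L57 (`s = 3/2`), so
the scaling-sharp, rate-OPTIMAL Sobolev ladder `‖u(t)‖_{Ḣ^s} ≳ ν^{(5−2s)/4}(T − t)^{−(2s−1)/4}` holds for EVERY
`s ∈ (1/2, 5/2)` (Robinson–Sadowski–Silva 2012, Thm. 1.1's range), the branch `s > 3/2` through Cheskidov–Zaya's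
Riccati law `y' ≲ y^{(2s+1)/(2s−1)}` rather than Benameur's `σ/3` (L54-H). The seminorm is the tree's
`Function.eHomSobolevSeminorm s` of the complexified slice. Necessity only. [cite: RobinsonSadowskiSilva2012, Thm. 1.1]
[cite: CheskidovZaya2016, Remark 2.3, Thm. 2.4] -/
theorem homSobolev_clock_gen (s : ℝ) (hs : s ∈ Ioo (3 / 2 : ℝ) (5 / 2)) :
    ∃ c : ℝ, 0 < c ∧ ∀ (ν T : ℝ), 0 < ν → 0 < T →
      ∀ (u : ℝ → EuclideanSpace ℝ (Fin 3) → EuclideanSpace ℝ (Fin 3)) (p : ℝ → EuclideanSpace ℝ (Fin 3) → ℝ),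
      IsMaximalSmoothSolution ν 0 u p T → IsLerayHopfOn T ν 0 (u 0) u →
      ∀ t ∈ Ioo 0 T,
        ENNReal.ofReal (c * ν ^ ((5 - 2 * s) / 4) * (T - t) ^ (-((2 * s - 1) / 4))) ≤
          Function.eHomSobolevSeminorm s (⇑EuclideanSpace.complexify ∘ u t) := by
  obtain ⟨c, hc, H⟩ := homSobolev_clock_gen_sq s hs
  refine ⟨c ^ (1 / 2 : ℝ), by positivity, fun ν T hν hT u p hmax hLH t ht => ?_⟩
  have hTt : 0 < T - t := sub_pos.2 ht.2
  have h := H ν T hν hT u p hmax hLH t ht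
  have hA : 0 ≤ c * ν ^ ((5 - 2 * s) / 2) * (T - t) ^ (-((2 * s - 1) / 2)) := by positivity
  have h' := ENNReal.rpow_le_rpow h (by norm_num : (0 : ℝ) ≤ 1 / 2)
  have hX : (Function.eHomSobolevSeminorm s (⇑EuclideanSpace.complexify ∘ u t) ^ 2) ^ (1 / 2 : ℝ) =
      Function.eHomSobolevSeminorm s (⇑EuclideanSpace.complexify ∘ u t) := by
    rw [← ENNReal.rpow_natCast, ← ENNReal.rpow_mul]
    norm_num
  rw [hX, ENNReal.ofReal_rpow_of_nonneg hA (by norm_num)] at h'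
  refine le_trans (le_of_eq ?_) h'
  congr 1
  rw [Real.mul_rpow (by positivity) (Real.rpow_nonneg hTt.le _), Real.mul_rpow hc.le (Real.rpow_nonneg hν.le _),
    ← Real.rpow_mul hν.le, ← Real.rpow_mul hTt.le]
  congr 2 <;> ring

end Summit.NavierStokesRegularity.FluidComputer.OptimalSobolevClock

end
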